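import Literature.MathematicalPhysics.QuantumManyBody.StateRelaxationDuality

/-!
# Factored ("few-squares", Burer–Monteiro / Gram-factor) state-relaxation certificates: positivity is structural

Companion of `StateRelaxationDuality` (weak duality for moment / bootstrap relaxations: an operator
identity `h − c·1 = Σᵢⱼ Λᵢⱼ Oᵢ⋆Oⱼ + n (+ r)` with `Λ ⪰ 0`, `ω(n) = 0` certifies `c (− ε) ≤ Re ω(h)`,
[KullEtAl2024, §5.3], [Han2020Bootstrap, §2 eq. (3)]). Burer–Monteiro's change of variables
[BurerMonteiro2003, §1 eq. (2), p. 330]: "we introduce the change of variables `X = V Vᵀ` where `V` is a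
real `n × n` matrix […] Since the positive semidefiniteness constraint has been eliminated, (2) has a
significant advantage over (1)" — read on the CERTIFICATE side: if the SOS multiplier is supplied as a Gram
FACTOR `L` (so `Λ = Lᴴ L`, any shape `k × m`, `k` = number of squares), no positive-semidefiniteness
check is needed at all, `Matrix.posSemidef_conjTranspose_mul_self` discharges it, and the certificate is
the plain sum of hermitian squares `Σ_k q_k⋆ q_k`, `q_k = Σ_j L_kj O_j`. The block version is the form
symmetry-reduced programs use: one factor per symmetry component `ρ`, residual `r` charged by `ε`.
This is the typed reader specification "Thm B" of cell hubbard-algo (seat p1, TARGET.md §1), written by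
that seat and landed verbatim up to docstrings. Everything here is PROVED; no named fact.
-/

noncomputable section

open Matrix Finset
open scoped ComplexOrder MatrixOrder BigOperators

namespace Literature.MathematicalPhysics.QuantumManyBody.StateRelaxation

variable {𝓐 : Type*} [Ring 𝓐] [StarRing 𝓐] [Algebra ℂ 𝓐] [StarModule ℂ 𝓐]

section OneBlock

variable {m k : Type*} [Fintype m] [Fintype k]

/-- **Factored certificate, one block.** `h − c·1 = Σᵢⱼ (LᴴL)ᵢⱼ Oᵢ⋆Oⱼ + n + r`, `ω(n) = 0`,
`−ε ≤ Re ω(r)` give `c − ε ≤ Re ω(h)` for every positive normalised `ω` — with NO hypothesis on `L`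
(a `k × m` matrix of any shape: `k` = number of squares): the `ε`-robust weak-duality bound with the
multiplier in Burer–Monteiro factored form. [cite: KullEtAl2024, §5.3]
[cite: BurerMonteiro2003, §1 eq. (2) (p. 330)] -/
theorem le_re_map_of_factoredCertificate_residual [DecidableEq m] (ω : 𝓐 →ₗ[ℂ] ℂ)
    (hpos : ∀ a, 0 ≤ ω (star a * a)) (hone : ω 1 = 1) (L : Matrix k m ℂ)
    (O : m → 𝓐) {h n r : 𝓐} (hn : ω n = 0) {ε : ℝ} (hr : -ε ≤ (ω r).re) {c : ℝ}
    (hcert : h - (c : ℂ) • (1 : 𝓐) = gramForm (Lᴴ * L) O + n + r) : c - ε ≤ (ω h).re :=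
  le_re_map_of_certificate_residual ω hpos hone (Matrix.posSemidef_conjTranspose_mul_self L) O hn
    hr hcert

/-- Exact version (no residual): `c ≤ Re ω(h)` from a factored certificate
`h − c·1 = Σᵢⱼ (LᴴL)ᵢⱼ Oᵢ⋆Oⱼ + n`. [cite: Han2020Bootstrap, §2 eq. (3)]
[cite: BurerMonteiro2003, §1 eq. (2) (p. 330)] -/
theorem le_re_map_of_factoredCertificate [DecidableEq m] (ω : 𝓐 →ₗ[ℂ] ℂ)
    (hpos : ∀ a, 0 ≤ ω (star a * a)) (hone : ω 1 = 1) (L : Matrix k m ℂ)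
    (O : m → 𝓐) {h n : 𝓐} (hn : ω n = 0) {c : ℝ}
    (hcert : h - (c : ℂ) • (1 : 𝓐) = gramForm (Lᴴ * L) O + n) : c ≤ (ω h).re :=
  le_re_map_of_certificate ω hpos hone (Matrix.posSemidef_conjTranspose_mul_self L) O hn hcert

end OneBlock

section Blocks

variable {ι : Type*} [Fintype ι] {mρ kρ : ι → Type*} [∀ ρ, Fintype (mρ ρ)] [∀ ρ, Fintype (kρ ρ)]

/-- **Factored certificate, block form** (one Gram factor `L ρ` per symmetry component `ρ`):
`h − c·1 = Σ_ρ Σᵢⱼ ((L ρ)ᴴ L ρ)ᵢⱼ (O ρ i)⋆(O ρ j) + n + r`, `ω(n) = 0`, `−ε ≤ Re ω(r)` give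
`c − ε ≤ Re ω(h)`; positivity of every block is structural. [cite: KullEtAl2024, §5.3]
[cite: BurerMonteiro2003, §1 eq. (2) (p. 330)] -/
theorem le_re_map_of_blockFactoredCertificate_residual [∀ ρ, DecidableEq (mρ ρ)]
    (ω : 𝓐 →ₗ[ℂ] ℂ) (hpos : ∀ a, 0 ≤ ω (star a * a)) (hone : ω 1 = 1)
    (L : ∀ ρ, Matrix (kρ ρ) (mρ ρ) ℂ) (O : ∀ ρ, mρ ρ → 𝓐) {h n r : 𝓐} (hn : ω n = 0)
    {ε : ℝ} (hr : -ε ≤ (ω r).re) {c : ℝ}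
    (hcert : h - (c : ℂ) • (1 : 𝓐) = (∑ ρ, gramForm ((L ρ)ᴴ * L ρ) (O ρ)) + n + r) :
    c - ε ≤ (ω h).re := by
  have hg : ∀ ρ, 0 ≤ (ω (gramForm ((L ρ)ᴴ * L ρ) (O ρ))).re := fun ρ =>
    (Complex.nonneg_iff.mp
      (map_gramForm_nonneg ω hpos (Matrix.posSemidef_conjTranspose_mul_self (L ρ)) (O ρ))).1
  have hωh : ω h = c + ω (∑ ρ, gramForm ((L ρ)ᴴ * L ρ) (O ρ)) + ω r := by
    have := congrArg ω hcert
    rw [map_sub, map_smul, hone, map_add, map_add, hn, add_zero, smul_eq_mul, mul_one] at this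
    linear_combination this
  have hsum : 0 ≤ (ω (∑ ρ, gramForm ((L ρ)ᴴ * L ρ) (O ρ))).re := by
    rw [map_sum, Complex.re_sum]
    exact Finset.sum_nonneg fun ρ _ => hg ρ
  rw [hωh, Complex.add_re, Complex.add_re, Complex.ofReal_re]
  linarith

end Blocks

end Literature.MathematicalPhysics.QuantumManyBody.StateRelaxation
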